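import Summits.CriticalPhenomena.PercolationContinuityZ3.Theorems.PercShatteringRaceNearLinearTwoClusterDecayOfTightKissGlue

/-!
# Crux `PercShatteringRace.NearLinearTwoClusterDecay` (stmt-CriticalPhenomena-5785), line `shell-product-kiss-positivity` —
# the certified composition `Tight ∧ KissPos ∧ BoundedFibre ⇒ NP_M ⇒ U(1/6)`

Over the route vocabulary `Theorems/PercShatteringRaceDefs.lean` (namespace `NearLinearTwoClusterDecayKiss`): the KISS
DESCENT of the line (idea card `shell-product-kiss-positivity`, planner skeleton; arithmetic verbatim) turns tightness of
the shell-crossing number at one bounded aspect, `GoodAt M (k₀ + 1)` (`P(N(r,Mr) ≤ k₀) ≥ c₀`), together with kiss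
positivity `KissPosAt M k` and the bounded-fibre shape atom `BoundedFibreAt M k` at every level `2 ≤ k ≤ k₀`, into
bounded-aspect non-proliferation `GoodAt M 2 = NP_M` (`goodAt_two_of_tight`), which the landed
`nearLinearTwoClusterDecay_of_goodAt` (route Defs file: closed-shell `NP_M` ⇒ clean open-shell `NP_{2M}` ⇒ orange-peeling
chain) carries to the crux BY NAME (`nearLinearTwoClusterDecay_of_tight_kiss`, registered bridge) and to
`PercFiniteBoxLRO.CritBoxTwoArmsDecay` (stmt-CriticalPhenomena-0859, `critBoxTwoArmsDecay_of_tight_kiss`).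
The three hypotheses are exactly the three OPEN registered stubs of the line (`stub_tightAtSomeAspect`,
`stub_kissPositivity`, `stub_boundedFibre`); everything else of the line is landed.  One descent step:
`P(N ≥ k) ≤ P(N = k) + P(N ≥ k+1)`, `c_t P(N = k) ≤ P(N = k, Kiss)` (kiss positivity),
`c_s P(N = k, Kiss) ≤ 1 - P(N ≥ k)` (kiss surgery, `kissSurgery_of_boundedFibre`), hence
`1 - P(N ≥ k) ≥ c_s c_t c_{k+1} / (1 + c_s c_t)` from `1 - P(N ≥ k+1) ≥ c_{k+1}`.
Lands with `--supports stmt-CriticalPhenomena-5785`.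
-/

noncomputable section

namespace Summit.CriticalPhenomena.PercolationContinuityZ3.Theorems.NearLinearTwoClusterDecayKiss

open MeasureTheory Filter
open Literature.Probability.LatticeModels Literature.Probability.Percolation

/-! ### The descent -/

/-- `{N ≥ k + 1} ⊆ {N ≥ k}` (drop the last crossing point). -/
theorem atLeast_succ_subset (r R k : ℕ) : AtLeast r R (k + 1) ⊆ AtLeast r R k := by
  rintro ω ⟨x, hx, hdis⟩
  refine ⟨fun i => x (Fin.castSucc i), fun i => hx _, fun i j hij => hdis _ _ ?_⟩
  exact fun h => hij (Fin.castSucc_injective _ h)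

/-- `{N ≥ k} ⊆ {N = k} ∪ {N ≥ k + 1}` (so `P(N ≥ k) ≤ P(N = k) + P(N ≥ k+1)` by subadditivity alone). -/
theorem atLeast_subset_level_union (r R k : ℕ) :
    AtLeast r R k ⊆ Level r R k ∪ AtLeast r R (k + 1) := by
  intro ω hω
  by_cases h : ω ∈ AtLeast r R (k + 1)
  · exact Or.inr h
  · exact Or.inl ⟨hω, h⟩

/-- **One step of the kiss descent**: for `2 ≤ k`, `GoodAt M (k + 1) → GoodAt M k` given kiss positivity and bounded
fibre at level `k`, with `c_k = c_s c_t c_{k+1} / (1 + c_s c_t)` (kiss positivity `c_t`,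
kiss surgery `c_s`). Only monotonicity and subadditivity of `(bondPercolation (zdGraph 3) (criticalProbI 3)).real` are used. -/
theorem descent_step {M k : ℕ} (hk : 2 ≤ k) (hKP : KissPosAt M k) (hBF : BoundedFibreAt M k)
    (h : GoodAt M (k + 1)) : GoodAt M k := by
  obtain ⟨c₁, hc₁, r₁, h₁⟩ := h
  obtain ⟨c₂, hc₂, r₂, h₂⟩ := hKP
  obtain ⟨c₃, hc₃, r₃, h₃⟩ := kissSurgery_of_boundedFibre hk hBF
  have hpos : 0 < 1 + c₃ * c₂ := by positivity
  refine ⟨c₃ * c₂ * c₁ / (1 + c₃ * c₂), by positivity, max r₁ (max r₂ r₃), fun r hr => ?_⟩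
  have hr₁ : r₁ ≤ r := le_trans (le_max_left _ _) hr
  have hr₂ : r₂ ≤ r := le_trans ((le_max_left _ _).trans (le_max_right _ _)) hr
  have hr₃ : r₃ ≤ r := le_trans ((le_max_right _ _).trans (le_max_right _ _)) hr
  have hu : (bondPercolation (zdGraph 3) (criticalProbI 3)).real (AtLeast r (M * r) k) ≤
      (bondPercolation (zdGraph 3) (criticalProbI 3)).real (Level r (M * r) k) + (bondPercolation (zdGraph 3) (criticalProbI 3)).real (AtLeast r (M * r) (k + 1)) :=
    (measureReal_mono (atLeast_subset_level_union r (M * r) k)).trans (measureReal_union_le _ _)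
  have e1 := h₁ r hr₁
  have e2 := h₂ r hr₂
  have e3 := h₃ r hr₃
  set u := (bondPercolation (zdGraph 3) (criticalProbI 3)).real (AtLeast r (M * r) k) with hu_def
  set u' := (bondPercolation (zdGraph 3) (criticalProbI 3)).real (AtLeast r (M * r) (k + 1)) with hu'_def
  set d := (bondPercolation (zdGraph 3) (criticalProbI 3)).real (Level r (M * r) k) with hd_def
  set t := (bondPercolation (zdGraph 3) (criticalProbI 3)).real (Level r (M * r) k ∩ Kiss r (M * r)) with ht_def
  have hd : u - 1 + c₁ ≤ d := by linarith
  have h4 : c₃ * c₂ * (u - 1 + c₁) ≤ 1 - u :=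
    calc c₃ * c₂ * (u - 1 + c₁) ≤ c₃ * c₂ * d := by
          apply mul_le_mul_of_nonneg_left hd; positivity
      _ = c₃ * (c₂ * d) := by ring
      _ ≤ c₃ * t := by apply mul_le_mul_of_nonneg_left e2 hc₃.le
      _ ≤ 1 - u := e3
  have key : c₃ * c₂ * c₁ / (1 + c₃ * c₂) ≤ 1 - u := by
    rw [div_le_iff₀ hpos]
    nlinarith [h4]
  linarith

/-- **The engine gives non-proliferation**: tightness `GoodAt M (k₀ + 1)` + kiss positivity + bounded fibre at the
levels `2 ≤ k ≤ k₀` ⟹ `NP_M = GoodAt M 2` (descend from level `k₀ + 1` to level `2`; for `k₀ ≤ 1` tightness is already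
`NP_M` by monotonicity). -/
theorem goodAt_two_of_tight {M k₀ : ℕ} (hT : GoodAt M (k₀ + 1))
    (hKP : ∀ k : ℕ, 2 ≤ k → k ≤ k₀ → KissPosAt M k) (hBF : ∀ k : ℕ, 2 ≤ k → k ≤ k₀ → BoundedFibreAt M k) :
    GoodAt M 2 := by
  rcases Nat.lt_or_ge k₀ 1 with hk | hk
  · have hk0 : k₀ = 0 := by omega
    subst hk0
    obtain ⟨c, hc, r₀, h₀⟩ := hT
    exact ⟨c, hc, r₀, fun r hr => (measureReal_mono (atLeast_succ_subset r (M * r) 1)).trans (h₀ r hr)⟩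
  · have key : ∀ d k : ℕ, 2 ≤ k → k + d = k₀ + 1 → GoodAt M k := by
      intro d
      induction d with
      | zero =>
        intro k _ hkd
        rw [Nat.add_zero] at hkd
        rw [hkd]
        exact hT
      | succ d ih =>
        intro k hk hkd
        exact descent_step hk (hKP k hk (by omega)) (hBF k hk (by omega)) (ih (k + 1) (by omega) (by omega))
    exact key (k₀ - 1) 2 le_rfl (by omega)

end Summit.CriticalPhenomena.PercolationContinuityZ3.Theorems.NearLinearTwoClusterDecayKiss

namespace Summit.CriticalPhenomena.PercolationContinuityZ3.Theorems

/-- **`NearLinearTwoClusterDecay` (U(1/6)) from the three open per-shell atoms of the line `shell-product-kiss-positivity`**: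
tightness of the shell-crossing number at SOME bounded aspect `M ≥ 2` (`GoodAt M (k₀+1)`), with kiss positivity and
bounded fibre at every level `2 ≤ k ≤ k₀` of that aspect. Registered bridge of the crux skeleton. -/
theorem nearLinearTwoClusterDecay_of_tight_kiss
    (h : ∃ M : ℕ, 2 ≤ M ∧ ∃ k₀ : ℕ, NearLinearTwoClusterDecayKiss.GoodAt M (k₀ + 1) ∧
      ∀ k : ℕ, 2 ≤ k → k ≤ k₀ →
        NearLinearTwoClusterDecayKiss.KissPosAt M k ∧ NearLinearTwoClusterDecayKiss.BoundedFibreAt M k) :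
    Summit.CriticalPhenomena.PercolationContinuityZ3.Theses.PercShatteringRace.NearLinearTwoClusterDecay := by
  obtain ⟨M, hM, k₀, hT, hk⟩ := h
  exact nearLinearTwoClusterDecay_of_goodAt ⟨M, hM, NearLinearTwoClusterDecayKiss.goodAt_two_of_tight hT
    (fun k hk2 hkk => (hk k hk2 hkk).1) (fun k hk2 hkk => (hk k hk2 hkk).2)⟩

/-- **`PercFiniteBoxLRO.CritBoxTwoArmsDecay` (stmt-CriticalPhenomena-0859) from the same three atoms.** -/
theorem critBoxTwoArmsDecay_of_tight_kiss
    (h : ∃ M : ℕ, 2 ≤ M ∧ ∃ k₀ : ℕ, NearLinearTwoClusterDecayKiss.GoodAt M (k₀ + 1) ∧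
      ∀ k : ℕ, 2 ≤ k → k ≤ k₀ →
        NearLinearTwoClusterDecayKiss.KissPosAt M k ∧ NearLinearTwoClusterDecayKiss.BoundedFibreAt M k) :
    Summit.CriticalPhenomena.PercolationContinuityZ3.Theses.PercFiniteBoxLRO.CritBoxTwoArmsDecay := by
  obtain ⟨M, hM, k₀, hT, hk⟩ := h
  exact critBoxTwoArmsDecay_of_goodAt ⟨M, hM, NearLinearTwoClusterDecayKiss.goodAt_two_of_tight hT
    (fun k hk2 hkk => (hk k hk2 hkk).1) (fun k hk2 hkk => (hk k hk2 hkk).2)⟩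

end Summit.CriticalPhenomena.PercolationContinuityZ3.Theorems

end
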